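import Summits.QuantumFields.BalabanUV.T4Continuum.Spine.NE1p.DressedRebornMuPartSeparableWitnessLive
import Summits.QuantumFields.BalabanUV.T4Continuum.Spine.NE1p.DressedSmallFieldPencilInjective

/-!
# T⁴ programme, spine estimate NE1′ (node O3b/H2) — WITNESS TAIL «THE SOURCE IS IDENTIFIABLE», PART 2 of 2: W87's RE-BORN μ-PART IS LIVE
# OVER EVERY NON-DEGENERATE COMPLEX RECTANGLE OF THE BI-PENCIL — complex sources `μ ≠ μ′`, complex contents `s ≠ s′`

Cell `pub-balaban`, sub-cell `t4`, row NE1′ formalisation crew (`t4/formal/NE1p/LEAVES.md` row **W100 ∕ DAG N29zzzzzo**; INTENT `HOME/CLAIMS.log`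
l.24957, STAGED l.25062, BOOKED typer RULING R-T154 l.25118; read X245), unit `b2b-balaban-t4-ne1p-formalise-leaf-09` (gen 15).  ADDITIVE — imports W87 PART 2
`Spine/NE1p/DressedRebornMuPartSeparableWitnessLive` (p243817; → PART 1 p243602, S56, W41, W35, W33, W24) and this row's PART 1
`Spine/NE1p/DressedSmallFieldPencilInjective` ONLY; re-enters W87's namespace; THEOREMS ONLY (0 def, 0 `def … : Prop`, 0 cite, 0 sorry,
0 `attribute`); W87's `actB_X₀` ∕ `crossDefect_eq` ∕ `exp_locE_actB` ∕ `actB_content_incr`, W35's `cM_pos`, W33's `integral_incr_pos` and PART 1's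
`pencil` ∕ `pencil_injOn` are used BY NAME — nothing restated.

WHAT.  W87 PART 2's `rebornMuPart_live` states the liveness of the re-born μ-part of the dressed one-cube output `E` over the rectangle
`{0, t} × {0, 1}` for a REAL source `0 < t ≤ 2` (positivity of W33's `∫incr`).  S56 §3's window END — fired by W87 PART 1 — is a statement on
the COMPLEX source disc `‖μ‖ ≤ μ₀ < 1`.  With PART 1's injectivity of the Gaussian-core pencil term the liveness extends to complex corners:
* §9 W87's separable closed form READ THROUGH the pencil term: `actB (μ, s) X₀ = (cM r∕2)·pencil r (s∕2) + (cM r∕2)·pencil r μ`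
  (`actB_X₀_eq_pencil`, W87's `actB_X₀` BY NAME — `rfl` on the integrals); the SOURCE increment `actB (μ,s) X₀ − actB (μ′,s) X₀ =
  (cM r∕2)·(pencil r μ − pencil r μ′)` and the CONTENT increment `actB (μ,s′) X₀ − actB (μ,s) X₀ = (cM r∕2)·(pencil r (s′∕2) − pencil r (s∕2))`;
  each is `≠ 0` for distinct parameters in the discs `‖μ‖,‖μ′‖ ≤ ρ`, `2ρr < 1` resp. `‖s‖,‖s′‖ ≤ σ`, `σr < 1` (PART 1's `pencil_injOn`;
  the content is read at half strength, hence the doubled content radius);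
* §10 **`rebornMuPart_live_complex`**: for `μ ≠ μ′`, `s ≠ s′` in those discs (and `ρ, σ ≤ 2`, so that every corner lies in the unit disc of
  W24's `exp_locE_cube` — W87's `exp_locE_actB`) the mixed difference `E(μ,s) − E(μ′,s) − (E(μ,s′) − E(μ′,s′)) ≠ 0`: exponentiating
  `E(μ,s) + E(μ′,s′) = E(μ′,s) + E(μ,s′)` makes W87's cross defect vanish, i.e. (`crossDefect_eq`) the PRODUCT of the two increments — each
  non-zero by §9;
* §11 **`rebornMuPart_live_source`** — THE SHAPE OF S56 §3's WINDOW: complex source `μ ≠ 0` with `‖μ‖ ≤ μ₀`, `2μ₀r < 1`, `μ₀ ≤ 2`, contents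
  `(1, 0)` as in PART 1's `rebornEnd_fires`: live, with NO content radius (the content increment is W87's REAL `actB_content_incr =
  (cM r∕2)·∫incr(r∕2) > 0`); `rebornMuPart_eq_zero_iff` (`↔ μ = 0` on the disc); closing `example` at `(r, μ₀, μ) = (r ≤ ½, ¾, i∕2)`-type
  data: for `r ≤ ½` the WHOLE window `‖μ‖ ≤ μ₀ < 1` of PART 1's END is covered.

LOCATED.  `2μ₀r < 1` is a SUFFICIENT radius of OUR method (PART 1); for `r > ½` it is a strict sub-disc of S56 §3's window `μ₀ < 1`, and
nothing is claimed outside it; W87's real-source `rebornMuPart_live` needs no radius and is NOT superseded.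

HONEST FRAMING.  A DECIDED TOY ([folklore]; 0 sorry; 0 citations; no `def`): W33's Gaussian cores on NE5's toy frame — the radius `2ρr < 1`
is OURS and only SUFFICIENT; a statement about the toy term, NOT about Bałaban's (2.14) densities; the separable placement and every numeral
OURS; (B1a) at the cores inside S56, (B1b) NOT claimed, (B3) = `hM3` BY CHOICE (G-ne9p2-5 UNPRINTED), (B5)-KIND clauses exactly as in W87; the
μ-extension READING stays the cell's, UNPRINTED (C-t4r2-340 (n1)), and so does the re-born-μ-part READING ([Balaban1989LargeFieldII] p. 356);
the liveness is a statement about THIS toy's logarithm as a function of the complex bi-pencil, NOT about Bałaban's densities; 0 binders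
instantiated on Bałaban's densities; no wall item; wall v1.8 (T4-DAG v48; v49–v52 verbatim) — words, not kind — does NOT move; R-t4r2-Q2
NOT met; NE1′ ⇐ the named binders — NOT proved, NOT printed; spine PROVED 0∕9; count 9 unchanged.  Rung (B)+1 on ONE finite four-torus —
NOT infinite volume, NOT a mass gap, NOT OS on ℝ⁴, NOT Clay.
HONEST DEPENDENCY: continuum YM on T⁴ ⇐ BetaPertH ∧ nine spine estimates (0/9 proved); BetaPertH ⇐ (D1) ∧ (D4) ∧ CAP+tail; G-an2-4
gates asym, D1 and NE2/3/4.
-/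

noncomputable section

namespace Summit.QuantumFields.BalabanUV.T4Continuum.NE1p.DressedRebornMuPartSeparableWitness

open Set Metric MeasureTheory Complex
open scoped BigOperators
open Literature.MathematicalPhysics.QuantumFieldTheory.Balaban1983to89
open Literature.MathematicalPhysics.QuantumFieldTheory.Balaban1983to89.B12TreeDecay (K₀)
open Literature.MathematicalPhysics.QuantumFieldTheory.Balaban1983to89.B13Resummation (locE)
open Literature.MathematicalPhysics.QuantumFieldTheory.Balaban1983to89.TreeLengthTorus (TDom tsys)
open Literature.MathematicalPhysics.QuantumFieldTheory.Balaban1983to89.TreeLengthTorusGeometry (tgeometry TTouch)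
open Summit.QuantumFields.BalabanUV.T4Continuum.NE1p.DressedSmallFieldTorusWitness (X₀)
open Summit.QuantumFields.BalabanUV.T4Continuum.NE1p.DressedSmallFieldCoresWitness (E1 crd incr integral_incr_pos)
open Summit.QuantumFields.BalabanUV.T4Continuum.NE1p.DressedSmallFieldCoresMassWitness (cM cM_pos)
open Summit.QuantumFields.BalabanUV.T4Continuum.NE1p.DressedSmallFieldPencilInjective (pencil pencil_injOn)

variable (r : ℝ) (hr : 0 ≤ r)

section Torus
variable (N : ℕ) [NeZero N]

/-! ## §9 W87's SEPARABLE CLOSED FORM READ THROUGH THE PENCIL TERM; the two increments and their non-vanishing on the discs -/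

/-- `actB (μ, s) X₀ = (cM r∕2)·pencil r (s∕2) + (cM r∕2)·pencil r μ` — W87's `actB_X₀`, the two integrals ARE PART 1's `pencil`. [folklore] -/
theorem actB_X₀_eq_pencil (k : ℕ) (μ s : ℂ) :
    actB r hr N k (μ, s) (X₀ N) = ((cM r / 2 : ℝ) : ℂ) * pencil r (s / 2) + ((cM r / 2 : ℝ) : ℂ) * pencil r μ := by
  rw [actB_X₀]; rfl

/-- THE SOURCE INCREMENT between two complex sources (any content): `(cM r∕2)·(pencil r μ − pencil r μ′)`. [folklore] -/
theorem actB_source_sub (k : ℕ) (μ μ' s : ℂ) :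
    actB r hr N k (μ, s) (X₀ N) - actB r hr N k (μ', s) (X₀ N) = ((cM r / 2 : ℝ) : ℂ) * (pencil r μ - pencil r μ') := by
  rw [actB_X₀_eq_pencil, actB_X₀_eq_pencil]; ring

/-- THE CONTENT INCREMENT between two complex contents (any source): `(cM r∕2)·(pencil r (s′∕2) − pencil r (s∕2))`. [folklore] -/
theorem actB_content_sub (k : ℕ) (μ s s' : ℂ) :
    actB r hr N k (μ, s') (X₀ N) - actB r hr N k (μ, s) (X₀ N) = ((cM r / 2 : ℝ) : ℂ) * (pencil r (s' / 2) - pencil r (s / 2)) := by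
  rw [actB_X₀_eq_pencil, actB_X₀_eq_pencil]; ring

/-- **THE SOURCE INCREMENT IS NOT ZERO** for distinct complex sources `μ ≠ μ′` with `‖μ‖, ‖μ′‖ ≤ ρ`, `2ρr < 1` (`0 < r`; PART 1's
`pencil_injOn`, W35's `cM_pos`). [folklore] -/
theorem actB_source_sub_ne_zero (hr0 : 0 < r) (k : ℕ) {ρ : ℝ} (h2 : 2 * ρ * r < 1) {μ μ' : ℂ} (hμ : ‖μ‖ ≤ ρ) (hμ' : ‖μ'‖ ≤ ρ)
    (hne : μ ≠ μ') (s : ℂ) : actB r hr N k (μ, s) (X₀ N) - actB r hr N k (μ', s) (X₀ N) ≠ 0 := by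
  rw [actB_source_sub]
  have hc : ((cM r / 2 : ℝ) : ℂ) ≠ 0 := by exact_mod_cast (half_pos (cM_pos r)).ne'
  refine mul_ne_zero hc (sub_ne_zero.2 fun h => hne ?_)
  exact pencil_injOn r hr0 ((norm_nonneg μ).trans hμ) h2 (mem_closedBall_zero_iff.2 hμ) (mem_closedBall_zero_iff.2 hμ') h

/-- **THE CONTENT INCREMENT IS NOT ZERO** for distinct complex contents `s ≠ s′` with `‖s‖, ‖s′‖ ≤ σ`, `σr < 1` — the content is read at HALF
strength, so PART 1's disc is entered at radius `σ∕2`. [folklore] -/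
theorem actB_content_sub_ne_zero (hr0 : 0 < r) (k : ℕ) {σ : ℝ} (h1 : σ * r < 1) {s s' : ℂ} (hs : ‖s‖ ≤ σ) (hs' : ‖s'‖ ≤ σ)
    (hne : s ≠ s') (μ : ℂ) : actB r hr N k (μ, s') (X₀ N) - actB r hr N k (μ, s) (X₀ N) ≠ 0 := by
  rw [actB_content_sub]
  have hc : ((cM r / 2 : ℝ) : ℂ) ≠ 0 := by exact_mod_cast (half_pos (cM_pos r)).ne'
  have hh : ∀ z : ℂ, ‖z‖ ≤ σ → ‖z / 2‖ ≤ σ / 2 := fun z hz => by rw [norm_div, Complex.norm_two]; linarith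
  refine mul_ne_zero hc (sub_ne_zero.2 fun h => hne ?_)
  have hinj := pencil_injOn r hr0 (ρ := σ / 2) (by linarith [norm_nonneg s, hh s hs]) (by linarith)
    (mem_closedBall_zero_iff.2 (hh s' hs')) (mem_closedBall_zero_iff.2 (hh s hs)) h
  linear_combination (-2 : ℂ) * hinj

/-! ## §10 THE RE-BORN μ-PART OF `E` OVER ANY NON-DEGENERATE COMPLEX RECTANGLE IS LIVE -/

open Classical in
/-- **COMPLEX-CORNER LIVENESS OF THE RE-BORN μ-PART** [decided toy]: for complex sources `μ ≠ μ′` (`‖·‖ ≤ ρ ≤ 2`, `2ρr < 1`) and complex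
contents `s ≠ s′` (`‖·‖ ≤ σ ≤ 2`, `σr < 1`) the mixed difference `E(μ,s) − E(μ′,s) − (E(μ,s′) − E(μ′,s′))` of the dressed one-cube
output is NOT zero: `E(μ,s) + E(μ′,s′) = E(μ′,s) + E(μ,s′)` exponentiates (W87's `exp_locE_actB` at the four corners) to a vanishing cross
defect, which W87's `crossDefect_eq` factorises into the source increment times (minus) the content increment — both non-zero by §9.
W87's `rebornMuPart_live` is the real rectangle `{t, 0} × {1, 0}` (radius-free). [folklore] -/
theorem rebornMuPart_live_complex (hr0 : 0 < r) (k : ℕ) {ρ σ : ℝ} (hρ2 : ρ ≤ 2) (hσ2 : σ ≤ 2) (h2 : 2 * ρ * r < 1)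
    (h1 : σ * r < 1) {μ μ' s s' : ℂ} (hμ : ‖μ‖ ≤ ρ) (hμ' : ‖μ'‖ ≤ ρ) (hs : ‖s‖ ≤ σ) (hs' : ‖s'‖ ≤ σ) (hμne : μ ≠ μ')
    (hsne : s ≠ s') :
    locE (tgeometry 4 N).ι (tgeometry 4 N).cubes (actB r hr N k (μ, s)) ((tgeometry 4 N).cubes (X₀ N)) -
          locE (tgeometry 4 N).ι (tgeometry 4 N).cubes (actB r hr N k (μ', s)) ((tgeometry 4 N).cubes (X₀ N)) -
        (locE (tgeometry 4 N).ι (tgeometry 4 N).cubes (actB r hr N k (μ, s')) ((tgeometry 4 N).cubes (X₀ N)) -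
          locE (tgeometry 4 N).ι (tgeometry 4 N).cubes (actB r hr N k (μ', s')) ((tgeometry 4 N).cubes (X₀ N))) ≠ 0 := by
  intro h
  have nμ : ‖μ‖ ≤ 2 := hμ.trans hρ2
  have nμ' : ‖μ'‖ ≤ 2 := hμ'.trans hρ2
  have ns : ‖s‖ ≤ 2 := hs.trans hσ2
  have ns' : ‖s'‖ ≤ 2 := hs'.trans hσ2
  have e11 := exp_locE_actB r hr N k nμ ns
  have e01 := exp_locE_actB r hr N k nμ' ns
  have e10 := exp_locE_actB r hr N k nμ ns'
  have e00 := exp_locE_actB r hr N k nμ' ns'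
  have h' : locE (TTouch (d := 4) (N := N)) (fun Z : (tsys 4 N).Dom => Z.1) (actB r hr N k (μ, s)) {0} -
        locE (TTouch (d := 4) (N := N)) (fun Z : (tsys 4 N).Dom => Z.1) (actB r hr N k (μ', s)) {0} -
      (locE (TTouch (d := 4) (N := N)) (fun Z : (tsys 4 N).Dom => Z.1) (actB r hr N k (μ, s')) {0} -
        locE (TTouch (d := 4) (N := N)) (fun Z : (tsys 4 N).Dom => Z.1) (actB r hr N k (μ', s')) {0}) = 0 := h
  have hsum : locE (TTouch (d := 4) (N := N)) (fun Z : (tsys 4 N).Dom => Z.1) (actB r hr N k (μ, s)) {0} +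
        locE (TTouch (d := 4) (N := N)) (fun Z : (tsys 4 N).Dom => Z.1) (actB r hr N k (μ', s')) {0} =
      locE (TTouch (d := 4) (N := N)) (fun Z : (tsys 4 N).Dom => Z.1) (actB r hr N k (μ', s)) {0} +
        locE (TTouch (d := 4) (N := N)) (fun Z : (tsys 4 N).Dom => Z.1) (actB r hr N k (μ, s')) {0} := by
    linear_combination h'
  have hexp := congrArg cexp hsum
  rw [Complex.exp_add, Complex.exp_add, e11, e00, e01, e10] at hexp
  have hdef := crossDefect_eq r hr N k μ μ' s s'
  rw [hexp, sub_self] at hdef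
  rcases mul_eq_zero.1 hdef.symm with hsrc | hcnt
  · exact actB_source_sub_ne_zero r hr N hr0 k h2 hμ hμ' hμne s hsrc
  · exact actB_content_sub_ne_zero r hr N hr0 k h1 hs hs' hsne μ hcnt

/-! ## §11 THE SHAPE OF S56 §3's WINDOW: a complex source against `0`, contents `(1, 0)` — no content radius -/

open Classical in
/-- **THE RE-BORN μ-PART OF `E` IS LIVE AT EVERY NON-ZERO COMPLEX SOURCE OF THE DISC `‖μ‖ ≤ μ₀`** (`2μ₀r < 1`, `μ₀ ≤ 2`) against the
source `0`, over PART 1's contents `(1, 0)`: the mixed difference `E(μ,1) − E(0,1) − (E(μ,0) − E(0,0))` — the quantity PART 1's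
`rebornEnd_fires` bounds by `4K₀μ₀‖v_B‖` — is NOT zero.  Source factor: PART 1's `pencil_injOn`; content factor: W87's REAL `actB_content_incr`
`= (cM r∕2)·∫incr(r∕2) > 0` (W33's `integral_incr_pos`) — no radius on the content side. [folklore] -/
theorem rebornMuPart_live_source (hr0 : 0 < r) (k : ℕ) {μ₀ : ℝ} (hμ₀2 : μ₀ ≤ 2) (h2 : 2 * μ₀ * r < 1) {μ : ℂ} (hμ : ‖μ‖ ≤ μ₀)
    (hne : μ ≠ 0) :
    locE (tgeometry 4 N).ι (tgeometry 4 N).cubes (actB r hr N k (μ, 1)) ((tgeometry 4 N).cubes (X₀ N)) -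
          locE (tgeometry 4 N).ι (tgeometry 4 N).cubes (actB r hr N k (0, 1)) ((tgeometry 4 N).cubes (X₀ N)) -
        (locE (tgeometry 4 N).ι (tgeometry 4 N).cubes (actB r hr N k (μ, 0)) ((tgeometry 4 N).cubes (X₀ N)) -
          locE (tgeometry 4 N).ι (tgeometry 4 N).cubes (actB r hr N k (0, 0)) ((tgeometry 4 N).cubes (X₀ N))) ≠ 0 := by
  intro h
  have nμ : ‖μ‖ ≤ 2 := hμ.trans hμ₀2
  have n1 : ‖(1 : ℂ)‖ ≤ 2 := by rw [norm_one]; norm_num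
  have n0 : ‖(0 : ℂ)‖ ≤ 2 := by rw [norm_zero]; norm_num
  have e11 := exp_locE_actB r hr N k nμ n1
  have e01 := exp_locE_actB r hr N k n0 n1
  have e10 := exp_locE_actB r hr N k nμ n0
  have e00 := exp_locE_actB r hr N k n0 n0
  have h' : locE (TTouch (d := 4) (N := N)) (fun Z : (tsys 4 N).Dom => Z.1) (actB r hr N k (μ, 1)) {0} -
        locE (TTouch (d := 4) (N := N)) (fun Z : (tsys 4 N).Dom => Z.1) (actB r hr N k (0, 1)) {0} -
      (locE (TTouch (d := 4) (N := N)) (fun Z : (tsys 4 N).Dom => Z.1) (actB r hr N k (μ, 0)) {0} -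
        locE (TTouch (d := 4) (N := N)) (fun Z : (tsys 4 N).Dom => Z.1) (actB r hr N k (0, 0)) {0}) = 0 := h
  have hsum : locE (TTouch (d := 4) (N := N)) (fun Z : (tsys 4 N).Dom => Z.1) (actB r hr N k (μ, 1)) {0} +
        locE (TTouch (d := 4) (N := N)) (fun Z : (tsys 4 N).Dom => Z.1) (actB r hr N k (0, 0)) {0} =
      locE (TTouch (d := 4) (N := N)) (fun Z : (tsys 4 N).Dom => Z.1) (actB r hr N k (0, 1)) {0} +
        locE (TTouch (d := 4) (N := N)) (fun Z : (tsys 4 N).Dom => Z.1) (actB r hr N k (μ, 0)) {0} := by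
    linear_combination h'
  have hexp := congrArg cexp hsum
  rw [Complex.exp_add, Complex.exp_add, e11, e00, e01, e10] at hexp
  have hdef := crossDefect_eq r hr N k μ 0 1 0
  rw [hexp, sub_self, ← neg_sub (actB r hr N k (μ, 1) (X₀ N)), actB_content_incr] at hdef
  have hc : ((cM r / 2 : ℝ) : ℂ) ≠ 0 := by exact_mod_cast (half_pos (cM_pos r)).ne'
  have hY : ((∫ v, incr (1 / 2 * r) v : ℝ) : ℂ) ≠ 0 := by exact_mod_cast (integral_incr_pos (1 / 2 * r) (by positivity)).ne'
  rcases mul_eq_zero.1 hdef.symm with hsrc | hcnt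
  · exact actB_source_sub_ne_zero r hr N hr0 k h2 hμ ((norm_zero (E := ℂ)).le.trans ((norm_nonneg μ).trans hμ)) hne 1 hsrc
  · exact (neg_ne_zero.2 (mul_ne_zero hc hY)) hcnt

open Classical in
/-- **… AND VANISHES ONLY AT THE CENTRE**: on the source disc `‖μ‖ ≤ μ₀` (`2μ₀r < 1`, `μ₀ ≤ 2`) the re-born μ-part over `{μ, 0} × {1, 0}` is
zero `↔ μ = 0`. [folklore] -/
theorem rebornMuPart_eq_zero_iff (hr0 : 0 < r) (k : ℕ) {μ₀ : ℝ} (hμ₀2 : μ₀ ≤ 2) (h2 : 2 * μ₀ * r < 1) {μ : ℂ} (hμ : ‖μ‖ ≤ μ₀) :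
    locE (tgeometry 4 N).ι (tgeometry 4 N).cubes (actB r hr N k (μ, 1)) ((tgeometry 4 N).cubes (X₀ N)) -
          locE (tgeometry 4 N).ι (tgeometry 4 N).cubes (actB r hr N k (0, 1)) ((tgeometry 4 N).cubes (X₀ N)) -
        (locE (tgeometry 4 N).ι (tgeometry 4 N).cubes (actB r hr N k (μ, 0)) ((tgeometry 4 N).cubes (X₀ N)) -
          locE (tgeometry 4 N).ι (tgeometry 4 N).cubes (actB r hr N k (0, 0)) ((tgeometry 4 N).cubes (X₀ N))) = 0 ↔ μ = 0 :=
  ⟨fun h => by_contra fun hne => rebornMuPart_live_source r hr N hr0 k hμ₀2 h2 hμ hne h, fun h => by rw [h]; ring⟩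

open Classical in
/-- **ON THE WHOLE WINDOW OF PART 1's END WHEN `r ≤ ½`**: at radius `r ≤ ½` the disc `2μ₀r < 1` contains every `μ₀ < 1`, so for EVERY
window `0 < μ₀ < 1` of `rebornEnd_fires` and every non-zero complex source in it the bounded quantity is live AND bounded by `4K₀μ₀‖v_B‖`
(PART 1's `rebornEnd_fires_closed` BY NAME). [folklore] -/
example (hr0 : 0 < r) (hrh : r ≤ 1 / 2) (k : ℕ) {μ₀ : ℝ} (h01 : μ₀ < 1) {μ : ℂ} (hμ : ‖μ‖ ≤ μ₀) (hne : μ ≠ 0) :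
    locE (tgeometry 4 N).ι (tgeometry 4 N).cubes (actB r hr N k (μ, 1)) ((tgeometry 4 N).cubes (X₀ N)) -
            locE (tgeometry 4 N).ι (tgeometry 4 N).cubes (actB r hr N k (0, 1)) ((tgeometry 4 N).cubes (X₀ N)) -
          (locE (tgeometry 4 N).ι (tgeometry 4 N).cubes (actB r hr N k (μ, 0)) ((tgeometry 4 N).cubes (X₀ N)) -
            locE (tgeometry 4 N).ι (tgeometry 4 N).cubes (actB r hr N k (0, 0)) ((tgeometry 4 N).cubes (X₀ N))) ≠ 0 ∧
      ‖locE (tgeometry 4 N).ι (tgeometry 4 N).cubes (actB r hr N k (μ, 1)) ((tgeometry 4 N).cubes (X₀ N)) -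
            locE (tgeometry 4 N).ι (tgeometry 4 N).cubes (actB r hr N k (0, 1)) ((tgeometry 4 N).cubes (X₀ N)) -
          (locE (tgeometry 4 N).ι (tgeometry 4 N).cubes (actB r hr N k (μ, 0)) ((tgeometry 4 N).cubes (X₀ N)) -
            locE (tgeometry 4 N).ι (tgeometry 4 N).cubes (actB r hr N k (0, 0)) ((tgeometry 4 N).cubes (X₀ N)))‖ ≤
        4 * K₀ 64 8 * μ₀ * ‖vB‖ := by
  have hμ₀0 : 0 ≤ μ₀ := (norm_nonneg μ).trans hμ
  exact ⟨rebornMuPart_live_source r hr N hr0 k (by linarith) (by nlinarith) hμ hne,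
    rebornEnd_fires_closed r hr N hr0 k h01 hμ⟩

/-- THE RADIUS IS THE METHOD's: at `r = 1` the source disc of §11 stops at `μ₀ < ½`, a strict sub-window of S56 §3's `μ₀ < 1`. [folklore] -/
example : ¬ (2 * (3 / 4 : ℝ) * 1 < 1) ∧ (2 * (3 / 4 : ℝ) * (1 / 2) < 1) := by norm_num

end Torus

end Summit.QuantumFields.BalabanUV.T4Continuum.NE1p.DressedRebornMuPartSeparableWitness

end
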